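import Summits.ValiantsHypothesis.ValiantsHypothesis.Theorems.LacunarySymmetroidMatrixDescartesCensusChamber1637PosP1
import Summits.ValiantsHypothesis.ValiantsHypothesis.Theorems.LacunarySymmetroidMatrixDescartesCensusChamber1637PosP2
import Summits.ValiantsHypothesis.ValiantsHypothesis.Theorems.LacunarySymmetroidMatrixDescartesCensusChamber1637PosP3
import Summits.ValiantsHypothesis.ValiantsHypothesis.Theorems.LacunarySymmetroidMatrixDescartesCensusChamber1637PosP4
import Summits.ValiantsHypothesis.ValiantsHypothesis.Theorems.LacunarySymmetroidMatrixDescartesCensusChamber1637PosP5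
import Summits.ValiantsHypothesis.ValiantsHypothesis.Theorems.LacunarySymmetroidMatrixDescartesCensusChamber1637PosP6
import Summits.ValiantsHypothesis.ValiantsHypothesis.Theorems.LacunarySymmetroidMatrixDescartesCensusChamber1637PosP7
import Summits.ValiantsHypothesis.ValiantsHypothesis.Theorems.LacunarySymmetroidMatrixDescartesCensusChamber1637PosP8
import Summits.ValiantsHypothesis.ValiantsHypothesis.Theorems.LacunarySymmetroidMatrixDescartesCensusChamber1637PosP9
import Summits.ValiantsHypothesis.ValiantsHypothesis.Theorems.LacunarySymmetroidMatrixDescartesCensusChamber1637PosP10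
import Summits.ValiantsHypothesis.ValiantsHypothesis.Theorems.LacunarySymmetroidMatrixDescartesCensusChamber1637PosP11
import Summits.ValiantsHypothesis.ValiantsHypothesis.Theorems.LacunarySymmetroidMatrixDescartesCensusChamber1637PosP12
import Summits.ValiantsHypothesis.ValiantsHypothesis.Theorems.LacunarySymmetroidMatrixDescartesCensusChamber1637PosP13
import Summits.ValiantsHypothesis.ValiantsHypothesis.Theorems.LacunarySymmetroidMatrixDescartesCensusChamber1637PosP14
import Summits.ValiantsHypothesis.ValiantsHypothesis.Theorems.LacunarySymmetroidMatrixDescartesCensusChamber1637PosP15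
import Summits.ValiantsHypothesis.ValiantsHypothesis.Theorems.LacunarySymmetroidMatrixDescartesCensusChamber1637PosP16
import Summits.ValiantsHypothesis.ValiantsHypothesis.Theorems.LacunarySymmetroidMatrixDescartesCensusChamber1637PosP17
import Summits.ValiantsHypothesis.ValiantsHypothesis.Theorems.LacunarySymmetroidMatrixDescartesCensusChamber1637PosP18
import Summits.ValiantsHypothesis.ValiantsHypothesis.Theorems.LacunarySymmetroidMatrixDescartesCensusChamber1637PosP19
import Summits.ValiantsHypothesis.ValiantsHypothesis.Theorems.LacunarySymmetroidMatrixDescartesCensusChamber1637PosP20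
import Summits.ValiantsHypothesis.ValiantsHypothesis.Theorems.LacunarySymmetroidMatrixDescartesCensusFanKit
import Summits.ValiantsHypothesis.ValiantsHypothesis.Theorems.LacunarySymmetroidMatrixDescartesCensusChamberSignCell

/-!
# `MatrixDescartes` census — chamber 1637: the `s = +` cell of a MAGNITUDE-level CHAMBER-UNIFORM door-A row by a PIECEWISE («fan») NFLOW certificate

HONEST FRAMING.  Object-search cell `pub-symmetroid`, door-A target `DoorA26 := PosRootLawAt 2 6 19`
(stmt-ValiantsHypothesis-19979; OPEN, typed, never asserted), crux `Theses.LacunarySymmetroid.MatrixDescartes`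
(stmt-ValiantsHypothesis-18050).  Chamber 1637 of theory g6's table (smallest member `(0,4,7,16,22,27)`, mirror 2366;
words `DIIDDD` / `IDDIII`).  The `s = +` cell has NO one-multiplier («NFLOW v4») certificate on the whole chamber cone (val-sym-door-p2 g3:
transport-limited / face conditions at colliding exponent directions); here the closed chamber cone is cut into the pieces of the NORMALISED-GAP FAN
with apex the smallest member `o`: piece `a` = «`g_a(d)/g_a(o)` is the smallest of the twenty normalised consecutive pair-sum gaps» (refined once more where
needed), and each piece is killed for every exponent vector by the exact multiplier of its piece group (files `…Chamber1637PosP<a>`, `…G<γ>Leaf`;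
kit j263974); the case split is `Census.min_cases20` (…CensusFanKit).
Nothing here bears on `V = 19`, on other chambers, on `DoorA26` as a whole (OPEN), on the crux, or on `VP ≠ VNP`.

[folklore] Kernel replay of exact certificates (generated by the seat's `gen6.py`); elementary.
-/

-- `Summit.ValiantsHypothesis.ValiantsHypothesis.…` repeats a component by the D-0017 layout
-- (single-conjunct summit), which the `dupNamespace` linter flags; the name is mandated.
set_option linter.dupNamespace false

namespace Summit.ValiantsHypothesis.ValiantsHypothesis.Theorems.LacunarySymmetroidMatrixDescartes.Census

open Polynomial Finset
open scoped BigOperators Polynomial Matrix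

set_option maxHeartbeats 16000000 in
set_option maxRecDepth 100000 in
/-- **Chamber 1637, orientation `s = +` (word `DIIDDD`): no real symmetric `2 × 2` six-term pencil on ANY exponent
vector of the chamber with `det S_0 > 0` has `20 = D(2,6)` distinct positive det-roots** — piecewise over the normalised-gap fan. [folklore] -/
theorem no_twenty_on_chamber1637_pos (d : Fin 6 → ℕ)
    (hd : StrictMono ((fun p : Fin 6 × Fin 6 => d p.1 + d p.2) ∘
      ![(0, 0), (0, 1), (0, 2), (1, 1), (1, 2), (2, 2), (0, 3), (1, 3), (0, 4), (2, 3), (1, 4),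
        (0, 5), (2, 4), (1, 5), (3, 3), (2, 5), (3, 4), (3, 5), (4, 4), (4, 5), (5, 5)]))
    (S : Fin 6 → Matrix (Fin 2) (Fin 2) ℝ) (hS : ∀ l, (S l).IsSymm)
    (hZ : 20 ≤ ((∑ l, ((X : ℝ[X]) ^ d l) • (S l).map C).det.roots.toFinset.filter (fun t => 0 < t)).card)
    (hs : 0 < (S 0 0 0 * S 0 1 1 - S 0 0 1 ^ 2)) : False := by
  rcases min_cases20
    (![(((d 0 : ℝ) + (d 1 : ℝ)) - ((d 0 : ℝ) + (d 0 : ℝ))) / (4 : ℝ),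
      (((d 0 : ℝ) + (d 2 : ℝ)) - ((d 0 : ℝ) + (d 1 : ℝ))) / (3 : ℝ),
      (((d 1 : ℝ) + (d 1 : ℝ)) - ((d 0 : ℝ) + (d 2 : ℝ))) / (1 : ℝ),
      (((d 1 : ℝ) + (d 2 : ℝ)) - ((d 1 : ℝ) + (d 1 : ℝ))) / (3 : ℝ),
      (((d 2 : ℝ) + (d 2 : ℝ)) - ((d 1 : ℝ) + (d 2 : ℝ))) / (3 : ℝ),
      (((d 0 : ℝ) + (d 3 : ℝ)) - ((d 2 : ℝ) + (d 2 : ℝ))) / (2 : ℝ),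
      (((d 1 : ℝ) + (d 3 : ℝ)) - ((d 0 : ℝ) + (d 3 : ℝ))) / (4 : ℝ),
      (((d 0 : ℝ) + (d 4 : ℝ)) - ((d 1 : ℝ) + (d 3 : ℝ))) / (2 : ℝ),
      (((d 2 : ℝ) + (d 3 : ℝ)) - ((d 0 : ℝ) + (d 4 : ℝ))) / (1 : ℝ),
      (((d 1 : ℝ) + (d 4 : ℝ)) - ((d 2 : ℝ) + (d 3 : ℝ))) / (3 : ℝ),
      (((d 0 : ℝ) + (d 5 : ℝ)) - ((d 1 : ℝ) + (d 4 : ℝ))) / (1 : ℝ),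
      (((d 2 : ℝ) + (d 4 : ℝ)) - ((d 0 : ℝ) + (d 5 : ℝ))) / (2 : ℝ),
      (((d 1 : ℝ) + (d 5 : ℝ)) - ((d 2 : ℝ) + (d 4 : ℝ))) / (2 : ℝ),
      (((d 3 : ℝ) + (d 3 : ℝ)) - ((d 1 : ℝ) + (d 5 : ℝ))) / (1 : ℝ),
      (((d 2 : ℝ) + (d 5 : ℝ)) - ((d 3 : ℝ) + (d 3 : ℝ))) / (2 : ℝ),
      (((d 3 : ℝ) + (d 4 : ℝ)) - ((d 2 : ℝ) + (d 5 : ℝ))) / (4 : ℝ),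
      (((d 3 : ℝ) + (d 5 : ℝ)) - ((d 3 : ℝ) + (d 4 : ℝ))) / (5 : ℝ),
      (((d 4 : ℝ) + (d 4 : ℝ)) - ((d 3 : ℝ) + (d 5 : ℝ))) / (1 : ℝ),
      (((d 4 : ℝ) + (d 5 : ℝ)) - ((d 4 : ℝ) + (d 4 : ℝ))) / (5 : ℝ),
      (((d 5 : ℝ) + (d 5 : ℝ)) - ((d 4 : ℝ) + (d 5 : ℝ))) / (5 : ℝ)] : Fin 20 → ℝ) with
    hu1 | hu1 | hu1 | hu1 | hu1 | hu1 | hu1 | hu1 | hu1 | hu1 | hu1 | hu1 | hu1 | hu1 | hu1 | hu1 | hu1 | hu1 | hu1 | hu1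
  · exact no_twenty_on_chamber1637_pos_p1 d hd hu1 S hS hZ hs
  · exact no_twenty_on_chamber1637_pos_p2 d hd hu1 S hS hZ hs
  · exact no_twenty_on_chamber1637_pos_p3 d hd hu1 S hS hZ hs
  · exact no_twenty_on_chamber1637_pos_p4 d hd hu1 S hS hZ hs
  · exact no_twenty_on_chamber1637_pos_p5 d hd hu1 S hS hZ hs
  · exact no_twenty_on_chamber1637_pos_p6 d hd hu1 S hS hZ hs
  · exact no_twenty_on_chamber1637_pos_p7 d hd hu1 S hS hZ hs
  · exact no_twenty_on_chamber1637_pos_p8 d hd hu1 S hS hZ hs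
  · exact no_twenty_on_chamber1637_pos_p9 d hd hu1 S hS hZ hs
  · exact no_twenty_on_chamber1637_pos_p10 d hd hu1 S hS hZ hs
  · exact no_twenty_on_chamber1637_pos_p11 d hd hu1 S hS hZ hs
  · exact no_twenty_on_chamber1637_pos_p12 d hd hu1 S hS hZ hs
  · exact no_twenty_on_chamber1637_pos_p13 d hd hu1 S hS hZ hs
  · exact no_twenty_on_chamber1637_pos_p14 d hd hu1 S hS hZ hs
  · exact no_twenty_on_chamber1637_pos_p15 d hd hu1 S hS hZ hs
  · exact no_twenty_on_chamber1637_pos_p16 d hd hu1 S hS hZ hs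
  · exact no_twenty_on_chamber1637_pos_p17 d hd hu1 S hS hZ hs
  · exact no_twenty_on_chamber1637_pos_p18 d hd hu1 S hS hZ hs
  · exact no_twenty_on_chamber1637_pos_p19 d hd hu1 S hS hZ hs
  · exact no_twenty_on_chamber1637_pos_p20 d hd hu1 S hS hZ hs

end Summit.ValiantsHypothesis.ValiantsHypothesis.Theorems.LacunarySymmetroidMatrixDescartes.Census
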